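import Literature.Probability.RandomPlanarGeometry.WholePlaneCaratheodory
import Literature.Probability.RandomPlanarGeometry.WholePlaneCurveAssembly
import HarnessLib

/-!
# The whole-plane curve from radial generation in the CLOSED disc (boundary hitting allowed)

Topic `Probability/RandomPlanarGeometry`; two definitions with bodies (`extInv`, `pieceCurveExt`) and
proved theorems (no named fact). Sequel of `WholePlaneCaratheodory` (continuous extension
`Φ̄_b` of `w ↦ F_b(1/w)` to the closed punctured disc when `K_b` is uniformly locally connected) and
of `WholePlaneRadialPiece` / `WholePlaneCurveAssembly` (the same construction for radial curves
staying INSIDE the disc). Here the radial curve `η` of the increment driver may touch the unit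
circle (as radial SLE_κ does for `κ > 4`); the piece is read through the extension:

* `pieceCurveExt lam b η s = Φ̄_b (T (η (s - b)))`, `T w = e^{-iλ_b} w̄`;
* `tendsto_invMap_pieceCurveExt` — it is the whole-plane tip: `F_s(R e^{iλ_s}) → γ_b(s)` as
  `R ↓ 1` (radial Markov property and the boundary continuity of `Φ̄_b`);
* `compl_hull_eq_unboundedComponent_ext` — the Markovian description
  `ℂ ∖ K_{b+u}` = unbounded component of `ℂ ∖ (γ_b((b, b+u]) ∪ K_b)`, where now points of the
  piece with `|T η| = 1` are boundary values of `Φ̄_b`, which lie in `K_b`;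
* `isCurve_tip_of_locallyGenerated` — **the whole-plane Loewner chain is generated by its tip
  path** as soon as, from base times unbounded below, the radial chain of the increment driver is
  generated by a continuous curve in the closed disc up to every time
  (`RadialSLE.LocallyGenerated (incr lam b) u₁` for all `u₁`): the hulls are uniformly locally
  connected (`isUniformlyLocallyConnected_hull`, via Moore's theorem), `Φ̄_b` exists, the pieces
  are continuous and are the tips, and `markov_of_base` / `isCurve_of_forall_lt` conclude.

This is Miller–Sheffield (2013), Prop. 2.5, deterministic part, without the hypothesis that the
radial pieces avoid the boundary.

## References

* J. Miller, S. Sheffield, *Imaginary geometry IV*, PTRF 169 (2017), arXiv:1302.4738, §2.1.3,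
  Prop. 2.5. [MillerSheffield2013]
* Ch. Pommerenke, *Boundary Behaviour of Conformal Maps*, Springer (1992), Thm. 2.1.
  [PommerenkeBBCM1992]
-/

noncomputable section

open Set Filter Topology Metric Complex
open scoped NNReal
open Literature.Topology.PlaneTopology

namespace Literature.Probability.RandomPlanarGeometry

namespace WholePlaneLoewnerChain

variable {lam : ℝ → ℝ}

/-- The **extended interior inverse** `Φ̄_b = extendFrom (𝔻 ∖ {0}) (w ↦ F_b(1/w))` (continuous on
`𝔻̄ ∖ {0}` when `K_b` is uniformly locally connected, `continuousOn_extendFrom_invMap_inv`).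
[cite: PommerenkeBBCM1992, Thm. 2.1] -/
def extInv (lam : ℝ → ℝ) (b : ℝ) : ℂ → ℂ :=
  extendFrom (ball (0 : ℂ) 1 \ {0}) fun w : ℂ ↦ WholePlaneLoewner.BackwardFlow.invMap lam b w⁻¹

/-- The **closed-disc piece** of the whole-plane curve from the base time `b`:
`γ_b(s) = Φ̄_b (T (η (s - b)))`. [cite: MillerSheffield2013, Prop. 2.5 (proof)] -/
def pieceCurveExt (lam : ℝ → ℝ) (b : ℝ) (η : ℝ≥0 → ℂ) (s : ℝ) : ℂ :=
  extInv lam b (reflRot lam b (η (s - b).toNNReal))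

section Piece

variable {b : ℝ} {u₂ : ℝ≥0} {η : ℝ≥0 → ℂ}

/-- `extInv` agrees with `w ↦ F_b(1/w)` on the punctured open disc. [folklore] -/
theorem extInv_eq (hlam : Continuous lam) {w : ℂ} (hw : w ∈ ball (0 : ℂ) 1 \ {0}) :
    extInv lam b w = WholePlaneLoewner.BackwardFlow.invMap lam b w⁻¹ :=
  extendFrom_extends (continuousOn_invMap_inv hlam) w hw

section WithEta

variable (hηle : ∀ s, ‖η s‖ ≤ 1)
  (hG : ∀ u : ℝ≥0, u ≤ u₂ → RadialLoewner.Disc.domain (incr lam b) u =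
    connectedComponentIn (ball (0 : ℂ) 1 \ η '' Icc 0 u) 0)
include hG

/-- **The radial domain of the interior picture** is the component of `0` in `𝔻 ∖ T(η[0, u])`.
[cite: MillerSheffield2013, §2.1.3] -/
theorem domain_shiftDriver_eq_component_reflRot {u : ℝ≥0} (hu : u ≤ u₂) :
    RadialLoewner.Disc.domain (WholePlaneLoewner.shiftDriver lam b) u =
      connectedComponentIn (ball (0 : ℂ) 1 \ (fun v ↦ reflRot lam b (η v)) '' Icc 0 u) 0 := by
  have h1 := RadialLoewner.Disc.domain_eq_component_conj (hG u hu)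
  have h2 := RadialLoewner.Disc.domain_eq_component_rotate h1 (-lam b)
  rw [shiftDriver_eq_incr, show (fun u ↦ -incr lam b u + -lam b) =
    fun v ↦ (fun v ↦ -incr lam b v) v + (-lam b) from rfl, h2]
  rfl

include hηle

/-- The interior coordinate `T(η v)` of the piece is in the closed punctured disc (`v ≤ u₂`).
[folklore] -/
theorem reflRot_eta_mem_closedBall {v : ℝ≥0} (hv : v ≤ u₂) :
    reflRot lam b (η v) ∈ closedBall (0 : ℂ) 1 \ {0} := by
  refine ⟨mem_closedBall_zero_iff.2 (by rw [norm_reflRot]; exact hηle v), ?_⟩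
  rw [mem_singleton_iff, reflRot, mul_eq_zero, not_or]
  exact ⟨Complex.exp_ne_zero _, fun h ↦ eta_ne_zero hG hv ((map_eq_zero _).1 h)⟩

/-- **The closed-disc piece is continuous** on `[b, b + u₂]` (given the continuity of `Φ̄_b`).
[folklore] -/
theorem continuousOn_pieceCurveExt (C : WholePlaneLoewnerChain lam) (hlam : Continuous lam)
    (hlc : IsUniformlyLocallyConnected (C.hull b)) (hηc : Continuous η) :
    ContinuousOn (pieceCurveExt lam b η) (Icc b (b + u₂)) := by
  refine (C.continuousOn_extendFrom_invMap_inv hlam hlc).1.comp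
    (((continuous_reflRot lam b).comp (hηc.comp (continuous_real_toNNReal.comp
      (continuous_sub_right b)))).continuousOn) fun s hs ↦ ?_
  exact reflRot_eta_mem_closedBall hηle hG (Real.toNNReal_le_iff_le_coe.2 (by linarith [hs.2]))

/-- **Points of the piece lie in `K_{b+u}`**, for `s ∈ (b, b + u]`: interior points by the radial
Markov property, boundary points because boundary values of `Φ̄_b` lie in `K_b`.
[cite: MillerSheffield2013, Prop. 2.5 (proof)] -/
theorem pieceCurveExt_mem_hull_add (C : WholePlaneLoewnerChain lam) (hlam : Continuous lam)
    (hlc : IsUniformlyLocallyConnected (C.hull b)) {u : ℝ≥0} (hu : u ≤ u₂) {s : ℝ}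
    (hs : s ∈ Ioc b (b + u)) : pieceCurveExt lam b η s ∈ C.hull (b + u) := by
  set v : ℝ≥0 := (s - b).toNNReal with hv
  have hv0 : (0 : ℝ) < s - b := by linarith [hs.1]
  have hvle : v ≤ u := Real.toNNReal_le_iff_le_coe.2 (by linarith [hs.2])
  set p : ℂ := reflRot lam b (η v) with hp
  have hpmem : p ∈ closedBall (0 : ℂ) 1 \ {0} := reflRot_eta_mem_closedBall hηle hG (hvle.trans hu)
  have hpE : p ∈ (fun v ↦ reflRot lam b (η v)) '' Icc 0 u := ⟨v, ⟨bot_le, hvle⟩, rfl⟩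
  show extInv lam b p ∈ C.hull (b + u)
  rcases (mem_closedBall_zero_iff.1 hpmem.1).eq_or_lt with h1 | h1
  · exact C.hull_mono (by simp) (C.extendFrom_invMap_inv_mem_hull hlam hlc h1)
  · have hpS : p ∈ ball (0 : ℂ) 1 \ {0} := ⟨mem_ball_zero_iff.2 h1, hpmem.2⟩
    rw [extInv_eq hlam hpS]
    by_contra hnot
    have hmem : (C.map b (WholePlaneLoewner.BackwardFlow.invMap lam b p⁻¹))⁻¹ ∈
        RadialLoewner.Disc.domain (WholePlaneLoewner.shiftDriver lam b) u := by
      have := (Set.ext_iff.1 (C.compl_hull_add_eq hlam b u) _).1 hnot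
      exact this.2
    rw [C.invCoord_invMap_inv hlam hpS.2 h1, domain_shiftDriver_eq_component_reflRot hG hu] at hmem
    exact (connectedComponentIn_subset _ _ hmem).2 hpE

/-- **The Markovian description with the closed-disc piece**: for `u ≤ u₂`,
`ℂ ∖ K_{b+u}` is the unbounded component of `ℂ ∖ (γ_b((b, b+u]) ∪ K_b)`.
[cite: MillerSheffield2013, Prop. 2.5 (proof)] -/
theorem compl_hull_eq_unboundedComponent_ext (C : WholePlaneLoewnerChain lam) (hlam : Continuous lam)
    (hlc : IsUniformlyLocallyConnected (C.hull b)) (hη0 : ‖η 0‖ = 1) {u : ℝ≥0} (hu : u ≤ u₂) :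
    (C.hull (b + u))ᶜ =
      Loewner.unboundedComponent (pieceCurveExt lam b η '' Ioc b (b + u) ∪ C.hull b)ᶜ := by
  set Ψ : ℂ → ℂ := fun z ↦ (C.map b z)⁻¹ with hΨ
  set E : Set ℂ := (fun v ↦ reflRot lam b (η v)) '' Icc 0 u with hE
  set γ := pieceCurveExt lam b η with hγ
  set V : Set ℂ := (γ '' Ioc b (b + u) ∪ C.hull b)ᶜ with hV
  have himg : Ψ '' (C.hull (b + u))ᶜ = connectedComponentIn (ball (0 : ℂ) 1 \ E) 0 \ {0} := by
    rw [C.image_invCoord_compl_hull hlam b u, domain_shiftDriver_eq_component_reflRot hG hu]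
  have hγK : ∀ s ∈ Ioc b (b + u), γ s ∈ C.hull (b + u) := fun s hs ↦
    pieceCurveExt_mem_hull_add hηle hG C hlam hlc hu hs
  have hQV : (C.hull (b + u))ᶜ ⊆ V := by
    rw [hV, compl_subset_compl]
    rintro z (⟨s, hs, rfl⟩ | hz)
    · exact hγK s hs
    · exact C.hull_mono (by simp) hz
  refine eq_unboundedComponent_of_saturated hQV (C.isConnected_compl_hull _).isPreconnected
    (by simpa using C.isBounded_hull (b + u)) (C.not_isBounded_compl_hull _) fun z hz y hy ↦ ?_
  set P := connectedComponentIn V z with hP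
  have hPV : P ⊆ V := connectedComponentIn_subset _ _
  have hVb : V ⊆ (C.hull b)ᶜ := fun x hx hxb ↦ hx (Or.inr hxb)
  have hPb : P ⊆ (C.hull b)ᶜ := hPV.trans hVb
  have hPconn : IsPreconnected (Ψ '' P) :=
    isPreconnected_connectedComponentIn.image Ψ ((C.continuousOn_invCoord b).mono hPb)
  -- `Ψ(P) ⊆ 𝔻 ∖ E`: a point of `P` with interior coordinate on `T(η(0, u])` would be a piece point
  have hPsub : Ψ '' P ⊆ ball (0 : ℂ) 1 \ E := by
    rintro _ ⟨x, hx, rfl⟩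
    have hxb : x ∉ C.hull b := hPb hx
    have hΨx : Ψ x ∈ ball (0 : ℂ) 1 \ {0} := C.invCoord_mem hxb
    refine ⟨hΨx.1, ?_⟩
    rintro ⟨v, hv, hvx⟩
    have hvx' : reflRot lam b (η v) = Ψ x := hvx
    rcases (v.2 : (0 : ℝ) ≤ v).eq_or_lt with h0 | h0
    · have hv0 : v = 0 := NNReal.coe_eq_zero.1 h0.symm
      have h1 : ‖Ψ x‖ = 1 := by rw [← hvx', hv0, norm_reflRot, hη0]
      have h2 := mem_ball_zero_iff.1 hΨx.1
      rw [h1] at h2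
      exact lt_irrefl _ h2
    · have hvpos : (0 : ℝ) < v := h0
      set s : ℝ := b + v with hsdef
      have hs : s ∈ Ioc b (b + u) := ⟨by rw [hsdef]; linarith, by
        have := NNReal.coe_le_coe.2 hv.2; rw [hsdef]; linarith⟩
      have hγs : γ s = x := by
        show extInv lam b (reflRot lam b (η (s - b).toNNReal)) = x
        have hsv : (s - b).toNNReal = v := by rw [hsdef, add_sub_cancel_left, Real.toNNReal_coe]
        rw [hsv, hvx', extInv_eq hlam hΨx]
        exact C.invMap_inv_invCoord hlam hxb
      exact hPV hx (Or.inl ⟨s, hs, hγs⟩)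
  have hzP : z ∈ P := mem_connectedComponentIn (hQV hz)
  have hΨz : Ψ z ∈ connectedComponentIn (ball (0 : ℂ) 1 \ E) 0 := by
    have : Ψ z ∈ connectedComponentIn (ball (0 : ℂ) 1 \ E) 0 \ {0} := himg ▸ mem_image_of_mem Ψ hz
    exact this.1
  have hPD : Ψ '' P ⊆ connectedComponentIn (ball (0 : ℂ) 1 \ E) 0 := by
    rw [connectedComponentIn_eq hΨz]
    exact hPconn.subset_connectedComponentIn (mem_image_of_mem Ψ hzP) hPsub
  have hΨy : Ψ y ∈ connectedComponentIn (ball (0 : ℂ) 1 \ E) 0 \ {0} :=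
    ⟨hPD (mem_image_of_mem Ψ hy), (C.invCoord_mem (hPb hy)).2⟩
  rw [← himg] at hΨy
  obtain ⟨x, hx, hxy⟩ := hΨy
  have : x = y := C.injOn_invCoord b (fun h ↦ hx (C.hull_mono (by simp) h)) (hPb hy) hxy
  exact this ▸ hx

/-- **The closed-disc piece is the whole-plane tip**: for `b < s ≤ b + u₂`,
`F_s(R e^{iλ_s}) → γ_b(s)` as `R ↓ 1`, granted the radial tips of the increment picture
`g_u⁻¹(r e^{iV_b(u)}) → η_u` (`r ↑ 1`). As `tendsto_invMap_pieceCurve`, with the boundary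
continuity of `Φ̄_b` at `T(η_u)` in place of interior continuity.
[cite: MillerSheffield2013, Prop. 2.5 (proof)] -/
theorem tendsto_invMap_pieceCurveExt (C : WholePlaneLoewnerChain lam) (hlam : Continuous lam)
    (hlc : IsUniformlyLocallyConnected (C.hull b))
    (htip : ∀ u : ℝ≥0, u ≤ u₂ → Tendsto (fun r : ℝ ↦ Function.invFunOn (RadialLoewner.Disc.map (incr lam b) u)
      (RadialLoewner.Disc.domain (incr lam b) u) ((r : ℂ) * Complex.exp ((incr lam b u : ℝ) * Complex.I)))
      (𝓝[<] 1) (𝓝 (η u)))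
    {s : ℝ} (hs : s ∈ Ioc b (b + u₂)) :
    Tendsto (fun R : ℝ ↦ WholePlaneLoewner.BackwardFlow.invMap lam s ((R : ℂ) * Complex.exp ((lam s : ℝ) * Complex.I)))
      (𝓝[>] 1) (𝓝 (pieceCurveExt lam b η s)) := by
  set u : ℝ≥0 := (s - b).toNNReal with hudef
  have hu0 : (0 : ℝ) < s - b := by linarith [hs.1]
  have hucoe : (u : ℝ) = s - b := Real.coe_toNNReal _ hu0.le
  have hbu : b + u = s := by rw [hucoe]; ring
  have hule : u ≤ u₂ := Real.toNNReal_le_iff_le_coe.2 (by linarith [hs.2])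
  have hVc : Continuous (incr lam b) := (hlam.comp (continuous_const.add NNReal.continuous_coe)).sub continuous_const
  set V := incr lam b with hVdef
  set Φ : ℂ → ℂ := fun w ↦ WholePlaneLoewner.BackwardFlow.invMap lam b w⁻¹ with hΦ
  set x : ℝ → ℂ := fun r ↦ Function.invFunOn (RadialLoewner.Disc.map V u) (RadialLoewner.Disc.domain V u)
    ((r : ℂ) * Complex.exp ((V u : ℝ) * Complex.I)) with hx
  -- the identity `F_s(R e^{iλ s}) = Φ (T (x R⁻¹))` for `R > 1`, and `T (x R⁻¹) ∈ 𝔻 ∖ {0}`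
  have key : ∀ R : ℝ, 1 < R → reflRot lam b (x R⁻¹) ∈ ball (0 : ℂ) 1 \ {0} ∧
      WholePlaneLoewner.BackwardFlow.invMap lam s ((R : ℂ) * Complex.exp ((lam s : ℝ) * Complex.I)) =
        Φ (reflRot lam b (x R⁻¹)) := by
    intro R hR
    have hR0 : 0 < R := zero_lt_one.trans hR
    have hr1 : R⁻¹ < 1 := inv_lt_one_of_one_lt₀ hR
    have hr0 : 0 < R⁻¹ := inv_pos.2 hR0
    have hy : ((R⁻¹ : ℝ) : ℂ) * Complex.exp ((V u : ℝ) * Complex.I) ∈ ball (0 : ℂ) 1 := by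
      rw [mem_ball_zero_iff, norm_mul, Complex.norm_exp_ofReal_mul_I, mul_one, Complex.norm_real,
        Real.norm_eq_abs, abs_of_pos hr0]
      exact hr1
    have hbij := RadialLoewner.Disc.bijOn_map hVc u
    have hex : ∃ a ∈ RadialLoewner.Disc.domain V u,
        RadialLoewner.Disc.map V u a = ((R⁻¹ : ℝ) : ℂ) * Complex.exp ((V u : ℝ) * Complex.I) := hbij.surjOn hy
    have hx1 : x R⁻¹ ∈ RadialLoewner.Disc.domain V u := Function.invFunOn_mem hex
    have hx2 : RadialLoewner.Disc.map V u (x R⁻¹) = ((R⁻¹ : ℝ) : ℂ) * Complex.exp ((V u : ℝ) * Complex.I) :=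
      Function.invFunOn_eq hex
    set w := reflRot lam b (x R⁻¹) with hw
    have hw1 : w ∈ RadialLoewner.Disc.domain (WholePlaneLoewner.shiftDriver lam b) u := by
      rw [shiftDriver_eq_incr]
      exact RadialLoewner.Disc.mem_domain_reflect_rotate (-lam b) hx1
    have hwball : ‖w‖ < 1 := mem_ball_zero_iff.1 (RadialLoewner.Disc.domain_subset _ _ hw1)
    have hw0 : w ≠ 0 := by
      intro h0
      have : RadialLoewner.Disc.map (WholePlaneLoewner.shiftDriver lam b) u w = 0 := by
        rw [h0]; exact RadialLoewner.Disc.map_zero (WholePlaneLoewner.continuous_shiftDriver hlam b) u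
      rw [hw, shiftDriver_eq_incr, reflRot, RadialLoewner.Disc.map_reflect_rotate hVc (-lam b) hx1, hx2,
        mul_eq_zero] at this
      rcases this with h | h
      · exact Complex.exp_ne_zero _ h
      · rw [map_eq_zero, mul_eq_zero] at h
        rcases h with h | h
        · exact hr0.ne' (by exact_mod_cast h)
        · exact Complex.exp_ne_zero _ h
    refine ⟨⟨mem_ball_zero_iff.2 hwball, hw0⟩, ?_⟩
    set z := Φ w with hz
    have hzb : z ∉ C.hull b := C.invMap_inv_notMem_hull hlam hw0 hwball
    have hzc : (C.map b z)⁻¹ = w := C.invCoord_invMap_inv hlam hw0 hwball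
    have hzs : z ∉ C.hull (b + u) := by
      rw [← mem_compl_iff, C.compl_hull_add_eq hlam b u]
      exact ⟨hzb, hzc ▸ hw1⟩
    have hmap : C.map (b + u) z = (R : ℂ) * Complex.exp ((lam s : ℝ) * Complex.I) := by
      rw [C.map_add_eq hlam hzs, hzc, hw, shiftDriver_eq_incr, reflRot,
        RadialLoewner.Disc.map_reflect_rotate hVc (-lam b) hx1, hx2]
      rw [show Complex.exp (((-lam b : ℝ) : ℂ) * Complex.I) * (starRingEnd ℂ)
          ((((R⁻¹ : ℝ) : ℂ)) * Complex.exp ((V u : ℝ) * Complex.I)) =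
          reflRot lam b ((((R⁻¹ : ℝ) : ℂ)) * Complex.exp ((incr lam b u : ℝ) * Complex.I)) from rfl,
        reflRot_approach, hbu, mul_inv, ← Complex.exp_neg]
      congr 1
      · push_cast; rw [inv_inv]
      · push_cast; ring_nf
    rw [hbu] at hzs hmap
    rw [← hmap, C.invMap_map hlam hzs]
  -- the limit, through the boundary continuity of `Φ̄_b` at `T(η u)`
  have hlim : Tendsto (fun R : ℝ ↦ Φ (reflRot lam b (x R⁻¹))) (𝓝[>] 1) (𝓝 (pieceCurveExt lam b η s)) := by
    have h1 : Tendsto (fun R : ℝ ↦ R⁻¹) (𝓝[>] (1 : ℝ)) (𝓝[<] (1 : ℝ)) := by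
      refine tendsto_nhdsWithin_iff.2 ⟨?_, ?_⟩
      · have := (continuousAt_inv₀ (one_ne_zero (α := ℝ))).tendsto
        rw [inv_one] at this
        exact this.mono_left nhdsWithin_le_nhds
      · filter_upwards [self_mem_nhdsWithin] with R hR using inv_lt_one_of_one_lt₀ (mem_Ioi.1 hR)
    have h2 : Tendsto (fun R : ℝ ↦ x R⁻¹) (𝓝[>] 1) (𝓝 (η u)) := (htip u hule).comp h1
    have h3 : Tendsto (fun R : ℝ ↦ reflRot lam b (x R⁻¹)) (𝓝[>] 1) (𝓝 (reflRot lam b (η u))) :=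
      ((continuous_reflRot lam b).tendsto _).comp h2
    have h3' : Tendsto (fun R : ℝ ↦ reflRot lam b (x R⁻¹)) (𝓝[>] 1)
        (𝓝[ball (0 : ℂ) 1 \ {0}] (reflRot lam b (η u))) := by
      refine tendsto_nhdsWithin_iff.2 ⟨h3, ?_⟩
      filter_upwards [self_mem_nhdsWithin] with R hR using (key R (mem_Ioi.1 hR)).1
    have hmem : reflRot lam b (η u) ∈ closedBall (0 : ℂ) 1 \ {0} := reflRot_eta_mem_closedBall hηle hG hule
    have h4 := (C.continuousOn_extendFrom_invMap_inv hlam hlc).2.2 _ hmem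
    exact h4.comp h3'
  refine hlim.congr' ?_
  filter_upwards [self_mem_nhdsWithin] with R hR
  exact (key R (mem_Ioi.1 hR)).2.symm

end WithEta

end Piece

/-! ### Assembly: the chain is generated by its tip path -/

/-- **The whole-plane Loewner chain is generated by its tip path, from radial generation of the
increments in the closed disc** (Miller–Sheffield (2013), Prop. 2.5, deterministic part, without
the boundary-avoidance hypothesis): if from base times `b ∈ B` unbounded below the radial chain of
the increment driver `V_b` is locally generated by a continuous curve in `𝔻̄` up to every time
(`RadialSLE.LocallyGenerated (incr lam b) u₁` for all `u₁`), then the tip limits exist at every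
time, the tip path is continuous and tends to `0` at `-∞`, and `C.IsCurve (tip lam)`.
[cite: MillerSheffield2013, Prop. 2.5 (proof)] -/
theorem isCurve_tip_of_locallyGenerated (C : WholePlaneLoewnerChain lam) (hlam : Continuous lam)
    {B : Set ℝ} (hB : ∀ T : ℝ, ∃ b ∈ B, b < T)
    (hloc : ∀ b ∈ B, ∀ u₁ : ℝ, RadialSLE.LocallyGenerated (incr lam b) u₁) :
    C.IsCurve (WholePlaneLoewner.tip lam) ∧
      ∀ s : ℝ, Tendsto (fun R : ℝ ↦
        WholePlaneLoewner.BackwardFlow.invMap lam s ((R : ℂ) * Complex.exp ((lam s : ℝ) * Complex.I)))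
        (𝓝[>] 1) (𝓝 (WholePlaneLoewner.tip lam s)) := by
  -- the generating data from a base `b ∈ B` up to `u₂`
  have hdata : ∀ b ∈ B, ∀ u₂ : ℝ≥0, ∃ η : ℝ≥0 → ℂ, Continuous η ∧ ‖η 0‖ = 1 ∧ (∀ s, ‖η s‖ ≤ 1) ∧
      (∀ u : ℝ≥0, u ≤ u₂ → RadialLoewner.Disc.domain (incr lam b) u =
        connectedComponentIn (ball (0 : ℂ) 1 \ η '' Icc 0 u) 0) ∧
      ∀ u : ℝ≥0, u ≤ u₂ → Tendsto (fun r : ℝ ↦ Function.invFunOn (RadialLoewner.Disc.map (incr lam b) u)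
        (RadialLoewner.Disc.domain (incr lam b) u) ((r : ℂ) * Complex.exp ((incr lam b u : ℝ) * Complex.I)))
        (𝓝[<] 1) (𝓝 (η u)) := by
    intro b hb u₂
    obtain ⟨η, hηc, hη0, hηle, hη⟩ := hloc b hb ((u₂ : ℝ) + 1) u₂ (by linarith)
    exact ⟨η, hηc, by rw [hη0, norm_one], hηle, fun u hu ↦ (hη u hu).1, fun u hu ↦ (hη u hu).2⟩
  -- every hull is uniformly locally connected
  have hulc : ∀ b : ℝ, IsUniformlyLocallyConnected (C.hull b) := by
    refine C.isUniformlyLocallyConnected_hull hlam hB fun a ha s ↦ ?_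
    obtain ⟨η, hηc, -, hηle, hG, -⟩ := hdata a ha s
    exact ⟨fun v ↦ reflRot lam a (η v), (continuous_reflRot lam a).comp hηc,
      domain_shiftDriver_eq_component_reflRot hG le_rfl⟩
  -- tip limits exist, and the tip path is the closed-disc piece from every base
  set γ : ℝ → ℂ := WholePlaneLoewner.tip lam with hγ
  have htend : ∀ s : ℝ, Tendsto (fun R : ℝ ↦
      WholePlaneLoewner.BackwardFlow.invMap lam s ((R : ℂ) * Complex.exp ((lam s : ℝ) * Complex.I)))
      (𝓝[>] 1) (𝓝 (γ s)) := by
    intro s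
    obtain ⟨b, hb, hbs⟩ := hB s
    obtain ⟨η, -, hη0, hηle, hG, htip⟩ := hdata b hb (s - b).toNNReal
    have hs : s ∈ Ioc b (b + (s - b).toNNReal) := ⟨hbs, by rw [Real.coe_toNNReal _ (by linarith)]; linarith⟩
    have h := tendsto_invMap_pieceCurveExt hηle hG C hlam (hulc b) htip hs
    rw [hγ, WholePlaneLoewner.tip, h.limUnder_eq]
    exact h
  have hpiece : ∀ b ∈ B, ∀ u₂ : ℝ≥0, ∀ η : ℝ≥0 → ℂ, (∀ s, ‖η s‖ ≤ 1) →
      (∀ u : ℝ≥0, u ≤ u₂ → RadialLoewner.Disc.domain (incr lam b) u =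
        connectedComponentIn (ball (0 : ℂ) 1 \ η '' Icc 0 u) 0) →
      (∀ u : ℝ≥0, u ≤ u₂ → Tendsto (fun r : ℝ ↦ Function.invFunOn (RadialLoewner.Disc.map (incr lam b) u)
        (RadialLoewner.Disc.domain (incr lam b) u) ((r : ℂ) * Complex.exp ((incr lam b u : ℝ) * Complex.I)))
        (𝓝[<] 1) (𝓝 (η u))) →
      ∀ s ∈ Ioc b (b + u₂), γ s = pieceCurveExt lam b η s := by
    intro b hb u₂ η hηle hG htip s hs
    exact tendsto_nhds_unique (htend s) (tendsto_invMap_pieceCurveExt hηle hG C hlam (hulc b) htip hs)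
  -- continuity of the tip path
  have hγc : Continuous γ := by
    refine continuous_iff_continuousAt.2 fun t ↦ ?_
    obtain ⟨b, hb, hbt⟩ := hB t
    set u₂ : ℝ≥0 := (t - b + 1).toNNReal with hu₂
    have hu₂c : ((u₂ : ℝ≥0) : ℝ) = t - b + 1 := Real.coe_toNNReal _ (by linarith)
    obtain ⟨η, hηc, -, hηle, hG, htip⟩ := hdata b hb u₂
    have heq : EqOn (pieceCurveExt lam b η) γ (Ioo b (b + u₂)) := fun s hs ↦
      (hpiece b hb u₂ η hηle hG htip s ⟨hs.1, hs.2.le⟩).symm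
    have hcont : ContinuousOn γ (Ioo b (b + u₂)) :=
      ((continuousOn_pieceCurveExt hηle hG C hlam (hulc b) hηc).mono Ioo_subset_Icc_self).congr
        (fun s hs ↦ (heq hs).symm)
    exact hcont.continuousAt (Ioo_mem_nhds hbt (by rw [hu₂c]; linarith))
  -- points of the tip path lie in the hull of their time
  have hγK : ∀ s : ℝ, γ s ∈ C.hull s := by
    intro s
    obtain ⟨b, hb, hbs⟩ := hB s
    set u : ℝ≥0 := (s - b).toNNReal with hu
    have huc : ((u : ℝ≥0) : ℝ) = s - b := Real.coe_toNNReal _ (by linarith)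
    have hbu : b + u = s := by rw [huc]; ring
    obtain ⟨η, -, -, hηle, hG, htip⟩ := hdata b hb u
    have hs : s ∈ Ioc b (b + u) := ⟨hbs, by rw [hbu]⟩
    rw [hpiece b hb u η hηle hG htip s hs]
    have := pieceCurveExt_mem_hull_add hηle hG C hlam (hulc b) le_rfl hs
    rwa [hbu] at this
  -- `γ(t) → 0` as `t → -∞`
  have h0 : Tendsto γ atBot (𝓝 0) := by
    refine tendsto_nhds.2 fun U hU h0U ↦ ?_
    obtain ⟨T₀, hT₀⟩ := (C.eventually_hull_subset (hU.mem_nhds h0U)).exists_forall_of_atBot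
    exact eventually_atBot.2 ⟨T₀, fun s hs ↦ hT₀ s hs (hγK s)⟩
  -- the Markovian description from every base time `T < t`
  refine ⟨C.isCurve_of_forall_lt hγc h0 fun T t hTt ↦ ?_, htend⟩
  obtain ⟨b, hb, hbT⟩ := hB T
  set u : ℝ≥0 := (t - b).toNNReal with hu
  have huc : ((u : ℝ≥0) : ℝ) = t - b := Real.coe_toNNReal _ (by linarith)
  have hbu : b + u = t := by rw [huc]; ring
  obtain ⟨η, -, hη0, hηle, hG, htip⟩ := hdata b hb u
  have ht := compl_hull_eq_unboundedComponent_ext hηle hG C hlam (hulc b) hη0 (le_refl u)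
  rw [hbu] at ht
  have himg : pieceCurveExt lam b η '' Ioc b t = γ '' Ioc b t :=
    image_congr fun s hs ↦ (hpiece b hb u η hηle hG htip s (by rwa [hbu])).symm
  rw [himg] at ht
  exact C.markov_of_base hbT hTt.le (fun s _ ↦ hγK s) ht

end WholePlaneLoewnerChain

end Literature.Probability.RandomPlanarGeometry
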